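import Mathlib
import Literature.NumberTheory.Sieve.MaynardTao
import HarnessLib

/-!
# Maynard 2015, Proposition 4.3 (3): `M_k > log k − 2 log log k − 2` for large `k` — proof

Topic `Literature/NumberTheory/Sieve`; a companion ("Proofs") file of `MaynardTao.lean`
discharging the named fact `Literature.NumberTheory.Sieve.exists_maynardFunctional_gt` (J. Maynard, *Small gaps between
primes*, Ann. of Math. (2) 181 (2015), 383–413, Proposition 4.3 (3); the docstring of the `def`
labels it "Prop. 4.3 (2)", the content is the third item of Prop. 4.3: for all sufficiently large
`k` there is an admissible `F` with `(∑ₘ J_k^{(m)}(F)) / I_k(F) > log k − 2 log log k − 2`).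
The printed proof is §8 "Choice of smooth weight for large `k`" of arXiv:1311.4600v3, pp. 17–18
(§7 of the journal version), displays (8.1)–(8.20); it is followed here step by step, with every
"sufficiently large" made explicit: the conclusion holds for all `k ≥ 2^{35}`
(`Literature.NumberTheory.Sieve.exists_maynardFunctional_gt_holds`).

## The printed proof and its formalisation

Maynard takes `F(t₁,…,t_k) = ∏ᵢ g(k tᵢ)` on `R_k` (and `0` outside), with `g` supported on
`[0, T]` ((8.1)). We work throughout in the scaled variable `x = u/k`, i.e. with the profile
`g(x)` supported on `[0, τ]`, `τ = T/k`, so that `F = 1_{R_k} · ∏ᵢ g(tᵢ)`; the source's `γ`, `μ`,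
`T` become `k ∫ g²`, `k (∫ x g²)/(∫ g²)`, `k τ`.

* `I_k(F) ≤ (∫ g²)^k` ((8.2); `maynardI_le_pow`), by dropping the constraint `∑ tᵢ ≤ 1` and
  Fubini (`MeasureTheory.integral_fintype_prod_volume_eq_pow`).
* `J_k^{(m)}(F) = ∫_{[0,1]^{k−1}} (∫₀¹ F(insertNth m u s) du)² ds` (`maynardJ_eq_integral_insertNth`:
  the integrand of `J_k^{(m)}` does not depend on `t_m ∈ [0,1]`; `MeasurableEquiv.piFinSuccAbove`
  is volume preserving), and on the fibres with `∑ⱼ sⱼ ≤ 1 − τ` the inner integral is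
  `(∫ g) ∏ⱼ g(sⱼ)` "by the support of `g`" (`intervalIntegral_testFunction_insertNth`), whence
  `J_k^{(m)}(F) ≥ (∫ g)² ∫_{∑ sⱼ ≤ 1−τ} ∏ⱼ g(sⱼ)²` ((8.3); `sq_mul_setIntegral_le_maynardJ`). In
  particular the bound is the same for every `m` (the source uses the symmetry of `F` instead).
* `∫_{∑ sⱼ ≤ 1−τ} ∏ g(sⱼ)² = (∫ g²)^{k−1} − E` with the tail
  `E = ∫_{∑ sⱼ > 1−τ} ∏ g(sⱼ)²` ((8.4)–(8.5); `pow_eq_setIntegral_add_setIntegral`), and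
  `E ≤ (k−1) (∫g²)^{k−2} τ (∫ x g²) / η²`, `η = 1 − τ − (k−1)ν`, `ν = (∫ x g²)/(∫ g²)`, by
  multiplying the integrand with `η^{-2} (∑ⱼ sⱼ − (k−1)ν)² ≥ 1` on the tail, expanding the square
  (the cross terms vanish since `ν` is the centre of mass of `g²`) and using `x² g² ≤ τ x g²`
  ((8.6)–(8.10); `integral_sq_sum_mul_prod`, `setIntegral_tail_prod_sq_le`).
* Together: `(∑ₘ J_k^{(m)})/I_k ≥ k (∫ g)²/(∫ g²) · (1 − (k−1) τ ν / η²)` ((8.11);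
  `le_maynardFunctional_indicator_prod`).
* With `g(x) = 1/(1 + Bx)` on `[0, τ]`, `B = Ak`, `1 + Bτ = e^A` ((8.17)–(8.18)) the three
  moments are `∫ g = log(1+Bτ)/B`, `∫ g² = (1 − 1/(1+Bτ))/B`, `∫ x g² = (log(1+Bτ) − 1 +
  1/(1+Bτ))/B²` ((8.19); `integral_indicator_inv`, `integral_indicator_inv_sq`,
  `integral_mul_indicator_inv_sq`, by the fundamental theorem of calculus), so that
  `k (∫g)²/∫g² = A/(1 − e^{−A})` and `kν = 1 − 1/A + 1/(e^A − 1)`.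
* With `A = log k − 2 log log k` (so `e^A = k/(log k)²`) and `log k ≥ 24`: `A ≥ 16`,
  `e^A − 1 ≥ A²/2`, `τ ≤ 1/(A (log k)²)`, `η ≥ 4/(5A)`, the error term is at most
  `25 A/(16 (log k)²) ≤ 1` and the loss `A · 25A/(16 (log k)²) ≤ 25/16 < 2`, giving
  `M(F) > A − 2 = log k − 2 log log k − 2` ((8.20); `largeK_numeric_bound`).
* Admissibility of `F` in the sense of `Literature.NumberTheory.Sieve.IsMaynardAdmissible` (measurable, supported on `R_k`,
  `F²` integrable on `R_k`, `I_k(F) > 0` — the last from `F ≥ e^{−kA}` on the box `[0, τ/k]^k ⊆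
  R_k`) is `isMaynardAdmissible_indicator_prod`.

No auxiliary definitions are introduced: the profile `g`, the product `G = ∏ g(tᵢ)` and
`F = 1_{R_k} G` enter the lemmas through hypotheses `hG : G = …`, `hF : F = …`.

## References

* J. Maynard, *Small gaps between primes*, Ann. of Math. (2) 181 (2015), 383–413,
  doi:10.4007/annals.2015.181.1.7; arXiv:1311.4600v3, Proposition 4.3 and §8 (pp. 17–18).
  [cite: MaynardAnnals2015]
* D. H. J. Polymath, *Variants of the Selberg sieve, and bounded intervals containing many
  primes*, Res. Math. Sci. 1:12 (2014), §3 (the square-integrable class of test functions used in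
  `IsMaynardAdmissible`). [cite: Polymath8b2014]
-/

noncomputable section

open MeasureTheory Set Filter
open scoped BigOperators

namespace Literature.NumberTheory.Sieve

namespace MaynardLargeK

/-! ### One-variable profiles supported in `[0, τ]` -/

section Profile

variable {g : ℝ → ℝ} {τ : ℝ}

/-- A measurable `g` with `|g| ≤ 1` vanishing off `[0, τ]`, multiplied by a continuous `φ`, is
integrable on `ℝ`. [folklore] -/
theorem integrable_mul_of_forall_mem_Icc (hg : Measurable g) (h1 : ∀ x, |g x| ≤ 1)
    (hsupp : ∀ x, g x ≠ 0 → x ∈ Icc 0 τ) {φ : ℝ → ℝ} (hφ : Continuous φ) :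
    Integrable fun x => φ x * g x := by
  have hint : IntegrableOn (fun x => φ x * g x) (Icc 0 τ) := by
    refine IntegrableOn.continuousOn_mul hφ.continuousOn ?_ isCompact_Icc
    refine Measure.integrableOn_of_bounded (M := 1) measure_Icc_lt_top.ne
      hg.aestronglyMeasurable ?_
    exact ae_of_all _ fun x => by rw [Real.norm_eq_abs]; exact h1 x
  refine hint.integrable_of_forall_notMem_eq_zero fun x hx => ?_
  have : g x = 0 := by
    by_contra h
    exact hx (hsupp x h)
  simp [this]

/-- Special case `φ = 1` of `integrable_mul_of_forall_mem_Icc`. [folklore] -/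
theorem integrable_of_forall_mem_Icc (hg : Measurable g) (h1 : ∀ x, |g x| ≤ 1)
    (hsupp : ∀ x, g x ≠ 0 → x ∈ Icc 0 τ) : Integrable g := by
  simpa using integrable_mul_of_forall_mem_Icc hg h1 hsupp continuous_const (φ := fun _ => 1)

/-- For `|g| ≤ 1` measurable vanishing off `[0, τ]`, `g²` is integrable. [folklore] -/
theorem integrable_sq_of_forall_mem_Icc (hg : Measurable g) (h1 : ∀ x, |g x| ≤ 1)
    (hsupp : ∀ x, g x ≠ 0 → x ∈ Icc 0 τ) : Integrable fun x => g x ^ 2 := by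
  refine (integrable_of_forall_mem_Icc hg h1 hsupp).mono ((hg.pow_const 2).aestronglyMeasurable)
    (ae_of_all _ fun x => ?_)
  rw [Real.norm_eq_abs, Real.norm_eq_abs, abs_pow, sq]
  exact mul_le_of_le_one_left (abs_nonneg _) (h1 x)

end Profile

/-! ### The product test function `F = 1_{R_k} · ∏ᵢ g(tᵢ)` (Maynard 2015, (8.1)) -/

section Product

variable {n : ℕ} {g : ℝ → ℝ} {τ : ℝ} {G F : (Fin (n + 1) → ℝ) → ℝ}

/-- `∏ᵢ g(tᵢ)` is measurable for measurable `g`. [folklore] -/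
theorem measurable_prodProfile (hg : Measurable g) (hG : G = fun t => ∏ i, g (t i)) :
    Measurable G := by
  rw [hG]
  exact Finset.measurable_prod _ fun i _ => hg.comp (measurable_pi_apply i)

/-- `0 ≤ ∏ᵢ g(tᵢ) ≤ 1` when `0 ≤ g ≤ 1`. [folklore] -/
theorem prodProfile_mem_Icc (h0 : ∀ x, 0 ≤ g x) (h1 : ∀ x, g x ≤ 1)
    (hG : G = fun t => ∏ i, g (t i)) (t : Fin (n + 1) → ℝ) : G t ∈ Icc (0 : ℝ) 1 := by
  rw [hG]
  exact ⟨Finset.prod_nonneg fun i _ => h0 _, Finset.prod_le_one (fun i _ => h0 _) fun i _ => h1 _⟩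

/-- The test function `F = 1_{R_k} ∏ᵢ g(tᵢ)` takes values in `[0, 1]` when `0 ≤ g ≤ 1`.
[folklore] -/
theorem testFunction_mem_Icc (h0 : ∀ x, 0 ≤ g x) (h1 : ∀ x, g x ≤ 1)
    (hG : G = fun t => ∏ i, g (t i)) (hF : F = (maynardSimplex (n + 1)).indicator G)
    (t : Fin (n + 1) → ℝ) : F t ∈ Icc (0 : ℝ) 1 := by
  rw [hF]
  by_cases ht : t ∈ maynardSimplex (n + 1)
  · rw [indicator_of_mem ht]; exact prodProfile_mem_Icc h0 h1 hG t
  · rw [indicator_of_notMem ht]; exact ⟨le_rfl, zero_le_one⟩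

/-- Splitting off the `m`-th coordinate: `∏ᵢ g((insertNth m u s)ᵢ) = g(u) ∏ⱼ g(sⱼ)`.
[folklore] -/
theorem prodProfile_insertNth (hG : G = fun t => ∏ i, g (t i)) (m : Fin (n + 1)) (u : ℝ)
    (s : Fin n → ℝ) : G (Fin.insertNth m u s) = g u * ∏ j, g (s j) := by
  rw [hG]
  dsimp only
  rw [Fin.prod_univ_succAbove _ m]
  simp only [Fin.insertNth_apply_same, Fin.insertNth_apply_succAbove]

/-- Membership of `insertNth m u s` in the simplex `R_{n+1}`. [folklore] -/
theorem insertNth_mem_maynardSimplex_iff (m : Fin (n + 1)) (u : ℝ) (s : Fin n → ℝ) :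
    Fin.insertNth m u s ∈ maynardSimplex (n + 1) ↔
      (0 ≤ u ∧ ∀ j, 0 ≤ s j) ∧ u + ∑ j, s j ≤ 1 := by
  simp only [maynardSimplex, mem_setOf_eq]
  rw [Fin.forall_iff_succAbove m, Fin.sum_univ_succAbove _ m]
  simp only [Fin.insertNth_apply_same, Fin.insertNth_apply_succAbove]

/-- Membership of `insertNth m x s` in the cube `[0,1]^{n+1}`. [folklore] -/
theorem insertNth_mem_maynardCube_iff (m : Fin (n + 1)) (x : ℝ) (s : Fin n → ℝ) :
    Fin.insertNth m x s ∈ maynardCube (n + 1) ↔ x ∈ Icc (0 : ℝ) 1 ∧ s ∈ maynardCube n := by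
  simp only [maynardCube, mem_univ_pi]
  rw [Fin.forall_iff_succAbove m]
  simp only [Fin.insertNth_apply_same, Fin.insertNth_apply_succAbove]

/-- The cube `[0,1]^k` is measurable. [folklore] -/
theorem measurableSet_maynardCube (k : ℕ) : MeasurableSet (maynardCube k) :=
  MeasurableSet.univ_pi fun _ => measurableSet_Icc

/-- **The value of `F` on a fibre.** If `g` vanishes off `[0, τ]` and `∑ⱼ sⱼ ≤ 1 − τ`, then
`F(insertNth m u s) = g(u) ∏ⱼ g(sⱼ)` for every `u`: the constraint `∑ tᵢ ≤ 1` is automatic on the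
support ("by the support of `g`, there are no further restrictions on the inner integral",
Maynard 2015, before (8.3)). [cite: MaynardAnnals2015, §8 of arXiv:1311.4600v3, (8.3)] -/
theorem testFunction_insertNth (hsupp : ∀ x, g x ≠ 0 → x ∈ Icc 0 τ)
    (hG : G = fun t => ∏ i, g (t i)) (hF : F = (maynardSimplex (n + 1)).indicator G)
    (m : Fin (n + 1)) {s : Fin n → ℝ} (hs : ∑ j, s j ≤ 1 - τ) (u : ℝ) :
    F (Fin.insertNth m u s) = g u * ∏ j, g (s j) := by
  by_cases hmem : Fin.insertNth m u s ∈ maynardSimplex (n + 1)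
  · rw [hF, indicator_of_mem hmem, prodProfile_insertNth hG]
  · -- off the simplex the product vanishes
    rw [hF, indicator_of_notMem hmem]
    symm
    by_contra hne
    have hu : g u ≠ 0 := fun h => hne (by rw [h, zero_mul])
    have hprod : ∏ j, g (s j) ≠ 0 := fun h => hne (by rw [h, mul_zero])
    have hsj : ∀ j, g (s j) ≠ 0 := fun j h =>
      hprod (Finset.prod_eq_zero (Finset.mem_univ j) h)
    refine hmem ((insertNth_mem_maynardSimplex_iff m u s).2 ⟨⟨(hsupp u hu).1, fun j =>
      (hsupp _ (hsj j)).1⟩, ?_⟩)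
    have := (hsupp u hu).2
    linarith

/-- The inner integral on a good fibre: for `∑ⱼ sⱼ ≤ 1 − τ`,
`∫₀¹ F(insertNth m u s) du = (∫₀¹ g) ∏ⱼ g(sⱼ)` (Maynard 2015, (8.3)).
[cite: MaynardAnnals2015, §8 of arXiv:1311.4600v3, (8.3)] -/
theorem intervalIntegral_testFunction_insertNth (hsupp : ∀ x, g x ≠ 0 → x ∈ Icc 0 τ)
    (hG : G = fun t => ∏ i, g (t i)) (hF : F = (maynardSimplex (n + 1)).indicator G)
    (m : Fin (n + 1)) {s : Fin n → ℝ} (hs : ∑ j, s j ≤ 1 - τ) :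
    ∫ u in (0 : ℝ)..1, F (Fin.insertNth m u s) = (∫ u in (0 : ℝ)..1, g u) * ∏ j, g (s j) := by
  simp_rw [testFunction_insertNth hsupp hG hF m hs]
  exact intervalIntegral.integral_mul_const _ _

/-! ### `J_k^{(m)}(F)` after splitting off the `m`-th coordinate -/

/-- **`J_k^{(m)}` on the split coordinates.** For `F` supported on `R_k` (`k = n + 1`),
`J_k^{(m)}(F) = ∫_{[0,1]^n} (∫₀¹ F(insertNth m u s) du)² ds`: the integrand of `J_k^{(m)}` does not
depend on `t_m ∈ [0, 1]`, a fibre of length `1` (`MeasurableEquiv.piFinSuccAbove`, volume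
preserving). [cite: MaynardAnnals2015, §8 of arXiv:1311.4600v3, definition of J_k before (8.3)] -/
theorem maynardJ_eq_integral_insertNth (m : Fin (n + 1)) {F : (Fin (n + 1) → ℝ) → ℝ}
    (hFsupp : Function.support F ⊆ maynardSimplex (n + 1)) :
    maynardJ (n + 1) m F =
      ∫ s in maynardCube n, (∫ u in (0 : ℝ)..1, F (Fin.insertNth m u s)) ^ 2 := by
  have hind : (maynardSimplex (n + 1)).indicator F = F := Set.indicator_eq_self.2 hFsupp
  set e := MeasurableEquiv.piFinSuccAbove (fun _ : Fin (n + 1) => ℝ) m with he_def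
  have he : MeasurePreserving e.symm volume volume :=
    (volume_preserving_piFinSuccAbove (fun _ : Fin (n + 1) => ℝ) m).symm
  have he_apply : ∀ p : ℝ × (Fin n → ℝ), e.symm p = Fin.insertNth m p.1 p.2 := fun p => by
    rw [he_def, MeasurableEquiv.piFinSuccAbove_symm_apply]; rfl
  -- the integrand as a function on the whole space
  obtain ⟨Φ, hΦ⟩ : ∃ Φ : (Fin (n + 1) → ℝ) → ℝ,
      Φ = fun t => (∫ u in (0 : ℝ)..1, F (Function.update t m u)) ^ 2 := ⟨_, rfl⟩
  obtain ⟨Ψ, hΨ⟩ : ∃ Ψ : (Fin n → ℝ) → ℝ,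
      Ψ = fun s => (∫ u in (0 : ℝ)..1, F (Fin.insertNth m u s)) ^ 2 := ⟨_, rfl⟩
  have hpt : ∀ p : ℝ × (Fin n → ℝ), (maynardCube (n + 1)).indicator Φ (e.symm p) =
      (Icc (0 : ℝ) 1).indicator (fun _ => (1 : ℝ)) p.1 * (maynardCube n).indicator Ψ p.2 := by
    rintro ⟨x, s⟩
    rw [he_apply]
    dsimp only
    by_cases hx : x ∈ Icc (0 : ℝ) 1
    · by_cases hs : s ∈ maynardCube n
      · rw [indicator_of_mem ((insertNth_mem_maynardCube_iff m x s).2 ⟨hx, hs⟩),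
          indicator_of_mem hx, indicator_of_mem hs, one_mul, hΦ, hΨ]
        simp only [Fin.update_insertNth]
      · rw [indicator_of_notMem (fun h => hs ((insertNth_mem_maynardCube_iff m x s).1 h).2),
          indicator_of_notMem hs, mul_zero]
    · rw [indicator_of_notMem (fun h => hx ((insertNth_mem_maynardCube_iff m x s).1 h).1),
        indicator_of_notMem hx, zero_mul]
  calc maynardJ (n + 1) m F = ∫ t in maynardCube (n + 1), Φ t := by rw [maynardJ, hind, hΦ]
    _ = ∫ t, (maynardCube (n + 1)).indicator Φ t :=
        (integral_indicator (measurableSet_maynardCube _)).symm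
    _ = ∫ p, (maynardCube (n + 1)).indicator Φ (e.symm p) := (he.integral_comp' _).symm
    _ = ∫ p : ℝ × (Fin n → ℝ), (Icc (0 : ℝ) 1).indicator (fun _ => (1 : ℝ)) p.1 *
          (maynardCube n).indicator Ψ p.2 := integral_congr_ae (ae_of_all _ hpt)
    _ = (∫ x, (Icc (0 : ℝ) 1).indicator (fun _ => (1 : ℝ)) x) *
          ∫ s, (maynardCube n).indicator Ψ s := by
        rw [Measure.volume_eq_prod]; exact integral_prod_mul _ _
    _ = ∫ s in maynardCube n, Ψ s := by
        rw [integral_indicator measurableSet_Icc, integral_indicator (measurableSet_maynardCube _),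
          setIntegral_const, smul_eq_mul, mul_one, Real.volume_real_Icc_of_le zero_le_one,
          sub_zero, one_mul]
    _ = _ := by rw [hΨ]

/-- The fibre integral `s ↦ ∫₀¹ F(insertNth m u s) du` is measurable (Fubini measurability).
[folklore] -/
theorem stronglyMeasurable_intervalIntegral_insertNth (m : Fin (n + 1))
    {F : (Fin (n + 1) → ℝ) → ℝ} (hFm : Measurable F) :
    StronglyMeasurable fun s : Fin n → ℝ => ∫ u in (0 : ℝ)..1, F (Fin.insertNth m u s) := by
  have h : StronglyMeasurable fun p : (Fin n → ℝ) × ℝ => F (Fin.insertNth m p.2 p.1) :=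
    (hFm.comp (continuous_snd.finInsertNth m continuous_fst).measurable).stronglyMeasurable
  have := h.integral_prod_right' (ν := volume.restrict (Ioc (0 : ℝ) 1))
  simp_rw [intervalIntegral.integral_of_le zero_le_one]
  exact this

/-- **Lower bound for `J_k^{(m)}` (Maynard 2015, (8.3)).** With `F = 1_{R_k} ∏ g(tᵢ)`,
`0 ≤ g ≤ 1` supported in `[0, τ]`, restricting the outer integral to `∑ⱼ sⱼ ≤ 1 − τ` (where the
inner integral is `(∫₀¹ g) ∏ g(sⱼ)`) gives
`J_k^{(m)}(F) ≥ (∫₀¹ g)² ∫_{∑ sⱼ ≤ 1 − τ} ∏ⱼ g(sⱼ)² ds`.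
[cite: MaynardAnnals2015, §8 of arXiv:1311.4600v3, (8.3)] -/
theorem sq_mul_setIntegral_le_maynardJ (hg : Measurable g) (h0 : ∀ x, 0 ≤ g x) (h1 : ∀ x, g x ≤ 1)
    (hsupp : ∀ x, g x ≠ 0 → x ∈ Icc 0 τ) (hτ1 : τ ≤ 1)
    (hG : G = fun t => ∏ i, g (t i)) (hF : F = (maynardSimplex (n + 1)).indicator G)
    (m : Fin (n + 1)) :
    (∫ u in (0 : ℝ)..1, g u) ^ 2 * ∫ s in {s : Fin n → ℝ | ∑ j, s j ≤ 1 - τ}, (∏ j, g (s j)) ^ 2 ≤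
      maynardJ (n + 1) m F := by
  have hFsupp : Function.support F ⊆ maynardSimplex (n + 1) := by
    rw [hF]; exact support_indicator_subset
  have hFm : Measurable F := by
    rw [hF]
    exact (measurable_prodProfile hg hG).indicator (measurableSet_maynardSimplex _)
  have hF01 := testFunction_mem_Icc h0 h1 hG hF
  rw [maynardJ_eq_integral_insertNth m hFsupp]
  set A : Set (Fin n → ℝ) := {s | ∑ j, s j ≤ 1 - τ} with hA
  have hAm : MeasurableSet A :=
    measurableSet_le (Finset.measurable_sum _ fun i _ => measurable_pi_apply i) measurable_const
  set c : ℝ := ∫ u in (0 : ℝ)..1, g u with hc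
  -- the product `P s = ∏ g(s j)` and its properties
  have hPm : Measurable fun s : Fin n → ℝ => ∏ j, g (s j) :=
    Finset.measurable_prod _ fun i _ => hg.comp (measurable_pi_apply i)
  have hP0 : ∀ s : Fin n → ℝ, 0 ≤ ∏ j, g (s j) := fun s => Finset.prod_nonneg fun j _ => h0 _
  have hP1 : ∀ s : Fin n → ℝ, ∏ j, g (s j) ≤ 1 := fun s =>
    Finset.prod_le_one (fun j _ => h0 _) fun j _ => h1 _
  have hPzero : ∀ s : Fin n → ℝ, s ∉ maynardCube n → ∏ j, g (s j) = 0 := by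
    intro s hs
    simp only [maynardCube, mem_univ_pi, not_forall] at hs
    obtain ⟨j, hj⟩ := hs
    refine Finset.prod_eq_zero (Finset.mem_univ j) ?_
    by_contra h
    have := hsupp _ h
    exact hj ⟨this.1, this.2.trans hτ1⟩
  have hc1 : |c| ≤ 1 := by
    have := intervalIntegral.norm_integral_le_of_norm_le_const (a := (0:ℝ)) (b := 1) (C := 1)
      (f := g) fun x _ => by rw [Real.norm_eq_abs, abs_of_nonneg (h0 x)]; exact h1 x
    simpa using this
  -- Step 1: `∫_{cube_n} A.indicator (c P)² ≤ ∫_{cube_n} Ψ`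
  have hstep : ∫ s in maynardCube n, A.indicator (fun s => (c * ∏ j, g (s j)) ^ 2) s ≤
      ∫ s in maynardCube n, (∫ u in (0 : ℝ)..1, F (Fin.insertNth m u s)) ^ 2 := by
    refine setIntegral_mono_on ?_ ?_ (measurableSet_maynardCube n) fun s hs => ?_
    · refine Integrable.integrableOn ((Integrable.indicator ?_ hAm))
      have habs : ∀ x, |g x| ≤ 1 := fun x => by rw [abs_of_nonneg (h0 x)]; exact h1 x
      have hP2int : Integrable fun s : Fin n → ℝ => ∏ j, g (s j) ^ 2 :=
        Integrable.fintype_prod (f := fun _ x => g x ^ 2)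
          fun _ => integrable_sq_of_forall_mem_Icc hg habs hsupp
      have heq : (fun s : Fin n → ℝ => (c * ∏ j, g (s j)) ^ 2) =
          fun s => c ^ 2 * ∏ j, g (s j) ^ 2 := by
        funext s; rw [mul_pow, Finset.prod_pow]
      rw [heq]
      exact hP2int.const_mul _
    · refine Measure.integrableOn_of_bounded (M := 1)
        ((isCompact_univ_pi fun _ => isCompact_Icc).measure_lt_top.ne)
        ((stronglyMeasurable_intervalIntegral_insertNth m hFm).measurable.pow_const 2
          |>.aestronglyMeasurable) (ae_of_all _ fun s => ?_)
      have hle : |∫ u in (0 : ℝ)..1, F (Fin.insertNth m u s)| ≤ 1 := by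
        have := intervalIntegral.norm_integral_le_of_norm_le_const (a := (0:ℝ)) (b := 1) (C := 1)
          (f := fun u => F (Fin.insertNth m u s)) fun x _ => by
            rw [Real.norm_eq_abs, abs_of_nonneg (hF01 _).1]; exact (hF01 _).2
        simpa using this
      rw [Real.norm_eq_abs, abs_pow]
      exact pow_le_one₀ (abs_nonneg _) hle
    · by_cases hsA : s ∈ A
      · rw [indicator_of_mem hsA,
          intervalIntegral_testFunction_insertNth hsupp hG hF m hsA]
      · rw [indicator_of_notMem hsA]; exact sq_nonneg _
  refine le_trans (le_of_eq ?_) hstep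
  -- Step 2: evaluate the left-hand side
  rw [setIntegral_indicator hAm]
  have hAsub : ∫ s in maynardCube n ∩ A, (c * ∏ j, g (s j)) ^ 2 =
      ∫ s in A, (c * ∏ j, g (s j)) ^ 2 := by
    refine (setIntegral_eq_of_subset_of_forall_sdiff_eq_zero hAm
      inter_subset_right fun s hs => ?_).symm
    have hsc : s ∉ maynardCube n := fun h => hs.2 ⟨h, hs.1⟩
    rw [hPzero s hsc, mul_zero, zero_pow two_ne_zero]
  rw [hAsub]
  simp_rw [mul_pow]
  rw [integral_const_mul]

/-! ### Bounds for `I_k(F)` and admissibility of `F` -/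

/-- `F²` is integrable on `R_k` (it is bounded by `1` and `R_k` is compact). [folklore] -/
theorem integrableOn_sq_indicator_prod (hg : Measurable g) (h0 : ∀ x, 0 ≤ g x) (h1 : ∀ x, g x ≤ 1)
    (hG : G = fun t => ∏ i, g (t i)) (hF : F = (maynardSimplex (n + 1)).indicator G)
    (S : Set (Fin (n + 1) → ℝ)) (hS : volume S ≠ ⊤) : IntegrableOn (fun t => F t ^ 2) S := by
  have hFm : Measurable F := by
    rw [hF]
    exact (measurable_prodProfile hg hG).indicator (measurableSet_maynardSimplex _)
  have hF01 := testFunction_mem_Icc h0 h1 hG hF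
  refine Measure.integrableOn_of_bounded (M := 1) hS (hFm.pow_const 2).aestronglyMeasurable
    (ae_of_all _ fun t => ?_)
  rw [Real.norm_eq_abs, abs_pow, abs_of_nonneg (hF01 t).1]
  exact pow_le_one₀ (hF01 t).1 (hF01 t).2

/-- **Upper bound for `I_k(F)` (Maynard 2015, (8.2)).** Dropping the constraint `∑ tᵢ ≤ 1`,
`I_k(F) ≤ ∫ ∏ᵢ g(tᵢ)² dt = (∫ g²)^k`. [cite: MaynardAnnals2015, §8 of arXiv:1311.4600v3, (8.2)] -/
theorem maynardI_le_pow (hg : Measurable g) (h0 : ∀ x, 0 ≤ g x) (h1 : ∀ x, g x ≤ 1)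
    (hsupp : ∀ x, g x ≠ 0 → x ∈ Icc 0 τ)
    (hG : G = fun t => ∏ i, g (t i)) (hF : F = (maynardSimplex (n + 1)).indicator G) :
    maynardI (n + 1) F ≤ (∫ x, g x ^ 2) ^ (n + 1) := by
  have habs : ∀ x, |g x| ≤ 1 := fun x => by rw [abs_of_nonneg (h0 x)]; exact h1 x
  have hGint : Integrable fun t : Fin (n + 1) → ℝ => ∏ i, g (t i) ^ 2 :=
    Integrable.fintype_prod (f := fun _ x => g x ^ 2)
      fun _ => integrable_sq_of_forall_mem_Icc hg habs hsupp
  calc maynardI (n + 1) F = ∫ t in maynardSimplex (n + 1), ∏ i, g (t i) ^ 2 := by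
        unfold maynardI
        refine setIntegral_congr_fun (measurableSet_maynardSimplex _) fun t ht => ?_
        rw [hF, indicator_of_mem ht, hG]
        dsimp only
        rw [Finset.prod_pow]
    _ ≤ ∫ t : Fin (n + 1) → ℝ, ∏ i, g (t i) ^ 2 :=
        setIntegral_le_integral hGint (ae_of_all _ fun t =>
          Finset.prod_nonneg fun i _ => sq_nonneg _)
    _ = (∫ x, g x ^ 2) ^ (n + 1) := by
        rw [integral_fintype_prod_volume_eq_pow (fun x => g x ^ 2), Fintype.card_fin]

/-- **Positivity of `I_k(F)`.** If moreover `g ≥ g₀ > 0` on `[0, τ]` with `0 < τ ≤ 1`, then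
`I_k(F) ≥ (τ/k)^k g₀^{2k} > 0` (the box `[0, τ/k]^k` lies in `R_k`). [folklore] -/
theorem maynardI_indicator_prod_pos (hg : Measurable g) (h0 : ∀ x, 0 ≤ g x) (h1 : ∀ x, g x ≤ 1)
    {g₀ : ℝ} (hg₀ : 0 < g₀) (hmin : ∀ x ∈ Icc 0 τ, g₀ ≤ g x) (hτ : 0 < τ) (hτ1 : τ ≤ 1)
    (hG : G = fun t => ∏ i, g (t i)) (hF : F = (maynardSimplex (n + 1)).indicator G) :
    0 < maynardI (n + 1) F := by
  have hk : (0 : ℝ) < n + 1 := by positivity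
  set Q : Set (Fin (n + 1) → ℝ) := Set.pi univ fun _ => Icc 0 (τ / (n + 1)) with hQ
  have hQsub : Q ⊆ maynardSimplex (n + 1) := by
    intro t ht
    simp only [hQ, mem_univ_pi, mem_Icc] at ht
    refine ⟨fun i => (ht i).1, ?_⟩
    calc ∑ i, t i ≤ ∑ _i : Fin (n + 1), τ / (n + 1) := Finset.sum_le_sum fun i _ => (ht i).2
      _ = τ := by
          rw [Finset.sum_const, Finset.card_univ, Fintype.card_fin, nsmul_eq_mul]
          push_cast; field_simp
      _ ≤ 1 := hτ1
  have hQm : MeasurableSet Q := MeasurableSet.univ_pi fun _ => measurableSet_Icc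
  have hvolQ : volume Q = ENNReal.ofReal ((τ / (n + 1)) ^ (n + 1)) := by
    rw [hQ, volume_pi_pi]
    simp only [Real.volume_Icc, sub_zero, Finset.prod_const, Finset.card_univ, Fintype.card_fin]
    rw [ENNReal.ofReal_pow (by positivity)]
  have hvolQ' : volume.real Q = (τ / (n + 1)) ^ (n + 1) := by
    rw [measureReal_def, hvolQ, ENNReal.toReal_ofReal (by positivity)]
  have hFQ : ∀ t ∈ Q, (g₀ ^ (n + 1)) ^ 2 ≤ F t ^ 2 := by
    intro t ht
    have ht' : ∀ i, t i ∈ Icc 0 (τ / (n + 1)) := fun i => ht i (mem_univ _)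
    rw [hF, indicator_of_mem (hQsub ht), hG]
    dsimp only
    have hle : g₀ ^ (n + 1) ≤ ∏ i, g (t i) := by
      calc g₀ ^ (n + 1) = ∏ _i : Fin (n + 1), g₀ := by simp
        _ ≤ ∏ i, g (t i) := Finset.prod_le_prod (fun i _ => hg₀.le) fun i _ =>
            hmin _ ⟨(ht' i).1, (ht' i).2.trans (div_le_self hτ.le (by linarith))⟩
    exact pow_le_pow_left₀ (by positivity) hle 2
  calc (0 : ℝ) < volume.real Q • (g₀ ^ (n + 1)) ^ 2 := by
        rw [hvolQ', smul_eq_mul]; positivity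
    _ ≤ ∫ t in Q, F t ^ 2 :=
        setIntegral_ge_of_const_le hQm (by rw [hvolQ]; exact ENNReal.ofReal_ne_top) hFQ
          (integrableOn_sq_indicator_prod hg h0 h1 hG hF Q (by rw [hvolQ]; exact ENNReal.ofReal_ne_top))
    _ ≤ maynardI (n + 1) F :=
        setIntegral_mono_set (integrableOn_sq_indicator_prod hg h0 h1 hG hF _
          (isCompact_maynardSimplex _).measure_lt_top.ne)
          (ae_of_all _ fun t => sq_nonneg _) (ae_of_all _ hQsub)

/-- **Admissibility of `F = 1_{R_k} ∏ g(tᵢ)`** for measurable `g` with `0 ≤ g ≤ 1`, `g ≥ g₀ > 0`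
on `[0, τ]`, `0 < τ ≤ 1`: `F` is measurable, supported on `R_k`, square-integrable, and
`I_k(F) > 0`. [cite: MaynardAnnals2015, §8 of arXiv:1311.4600v3, (8.1)] -/
theorem isMaynardAdmissible_indicator_prod (hg : Measurable g) (h0 : ∀ x, 0 ≤ g x)
    (h1 : ∀ x, g x ≤ 1) {g₀ : ℝ} (hg₀ : 0 < g₀) (hmin : ∀ x ∈ Icc 0 τ, g₀ ≤ g x) (hτ : 0 < τ)
    (hτ1 : τ ≤ 1) (hG : G = fun t => ∏ i, g (t i))
    (hF : F = (maynardSimplex (n + 1)).indicator G) : IsMaynardAdmissible (n + 1) F where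
  measurable := by
    rw [hF]
    exact (measurable_prodProfile hg hG).indicator (measurableSet_maynardSimplex _)
  support_subset := by rw [hF]; exact support_indicator_subset
  integrableOn_sq := integrableOn_sq_indicator_prod hg h0 h1 hG hF _
    (isCompact_maynardSimplex _).measure_lt_top.ne
  maynardI_pos := maynardI_indicator_prod_pos hg h0 h1 hg₀ hmin hτ hτ1 hG hF

end Product

/-! ### The second-moment (Chebyshev) bound for the tail `∑ⱼ sⱼ > 1 − τ` -/

section SecondMoment

variable {n : ℕ}

/-- Expanding `(∑ⱼ a(sⱼ))² ∏ⱼ w(sⱼ)` as a double sum of products of one-variable factors.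
[folklore] -/
theorem sq_sum_mul_prod_eq (w a : ℝ → ℝ) (s : Fin n → ℝ) :
    (∑ j, a (s j)) ^ 2 * ∏ j, w (s j) =
      ∑ i, ∑ j, ∏ l, (w (s l) * ((if l = i then a (s l) else 1) * (if l = j then a (s l) else 1))) := by
  classical
  have hterm : ∀ i j : Fin n, a (s i) * a (s j) * ∏ l, w (s l) =
      ∏ l, (w (s l) * ((if l = i then a (s l) else 1) * (if l = j then a (s l) else 1))) := by
    intro i j
    simp only [Finset.prod_mul_distrib, Finset.prod_ite_eq', Finset.mem_univ, if_true]
    ring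
  rw [sq, Finset.sum_mul_sum, Finset.sum_mul]
  refine Finset.sum_congr rfl fun i _ => ?_
  rw [Finset.sum_mul]
  exact Finset.sum_congr rfl fun j _ => hterm i j

/-- Integrability of the one-variable factors `w`, `a w`, `a² w` of the expansion. [folklore] -/
theorem integrable_expansionFactor {w a : ℝ → ℝ} (hw : Integrable w)
    (hwa : Integrable fun x => a x * w x) (hwa2 : Integrable fun x => a x ^ 2 * w x)
    (i j l : Fin n) :
    Integrable fun x => w x * ((if l = i then a x else 1) * (if l = j then a x else 1)) := by
  by_cases hi : l = i <;> by_cases hj : l = j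
  · simp only [if_pos hi, if_pos hj]
    have : (fun x => w x * (a x * a x)) = fun x => a x ^ 2 * w x := by funext x; ring
    rw [this]; exact hwa2
  · simp only [if_pos hi, if_neg hj, mul_one]
    have : (fun x => w x * a x) = fun x => a x * w x := by funext x; ring
    rw [this]; exact hwa
  · simp only [if_neg hi, if_pos hj, one_mul]
    have : (fun x => w x * a x) = fun x => a x * w x := by funext x; ring
    rw [this]; exact hwa
  · simp only [if_neg hi, if_neg hj, mul_one]
    exact hw

/-- Integrability of `(∑ⱼ a(sⱼ))² ∏ⱼ w(sⱼ)` on `ℝⁿ`. [folklore] -/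
theorem integrable_sq_sum_mul_prod {w a : ℝ → ℝ} (hw : Integrable w)
    (hwa : Integrable fun x => a x * w x) (hwa2 : Integrable fun x => a x ^ 2 * w x) :
    Integrable fun s : Fin n → ℝ => (∑ j, a (s j)) ^ 2 * ∏ j, w (s j) := by
  simp_rw [sq_sum_mul_prod_eq w a]
  refine integrable_finsetSum _ fun i _ => integrable_finsetSum _ fun j _ => ?_
  exact Integrable.fintype_prod
    (f := fun l x => w x * ((if l = i then a x else 1) * (if l = j then a x else 1)))
    (integrable_expansionFactor hw hwa hwa2 i j)

/-- **Variance of a sum of independent variables, as an integral identity.** If `∫ a w = 0` then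
`∫ (∑ⱼ a(sⱼ))² ∏ⱼ w(sⱼ) ds = n (∫ w)^{n−1} ∫ a² w` (the cross terms vanish; Maynard 2015, the
computation (8.8)–(8.9)). [cite: MaynardAnnals2015, §8 of arXiv:1311.4600v3, (8.8)–(8.9)] -/
theorem integral_sq_sum_mul_prod {w a : ℝ → ℝ} (hw : Integrable w)
    (hwa : Integrable fun x => a x * w x) (hwa2 : Integrable fun x => a x ^ 2 * w x)
    (h0 : ∫ x, a x * w x = 0) :
    ∫ s : Fin n → ℝ, (∑ j, a (s j)) ^ 2 * ∏ j, w (s j) =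
      n * (∫ x, w x) ^ (n - 1) * ∫ x, a x ^ 2 * w x := by
  classical
  set h : Fin n → Fin n → Fin n → ℝ → ℝ := fun i j l x =>
    w x * ((if l = i then a x else 1) * (if l = j then a x else 1)) with hh
  have hint : ∀ i j l, Integrable (h i j l) := fun i j l => integrable_expansionFactor hw hwa hwa2 i j l
  have hval : ∀ i j, ∫ s : Fin n → ℝ, ∏ l, h i j l (s l) =
      if i = j then (∫ x, a x ^ 2 * w x) * (∫ x, w x) ^ (n - 1) else 0 := by
    intro i j
    rw [integral_fintype_prod_volume_eq_prod]
    split_ifs with hij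
    · subst hij
      rw [← Finset.mul_prod_erase Finset.univ _ (Finset.mem_univ i)]
      congr 1
      · simp only [hh, if_true]
        refine integral_congr_ae (ae_of_all _ fun x => ?_)
        dsimp only
        ring
      · rw [Finset.prod_congr rfl fun l hl => ?_, Finset.prod_const,
          Finset.card_erase_of_mem (Finset.mem_univ i), Finset.card_univ, Fintype.card_fin]
        have hl' : l ≠ i := Finset.ne_of_mem_erase hl
        simp only [hh, hl', if_false, mul_one]
    · refine Finset.prod_eq_zero (Finset.mem_univ i) ?_
      have : h i j i = fun x => a x * w x := by
        funext x
        simp only [hh, if_true, if_neg hij, mul_one]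
        ring
      rw [this, h0]
  calc ∫ s : Fin n → ℝ, (∑ j, a (s j)) ^ 2 * ∏ j, w (s j)
      = ∫ s : Fin n → ℝ, ∑ i, ∑ j, ∏ l, h i j l (s l) := by
        refine integral_congr_ae (ae_of_all _ fun s => ?_)
        exact sq_sum_mul_prod_eq w a s
    _ = ∑ i, ∑ j, ∫ s : Fin n → ℝ, ∏ l, h i j l (s l) := by
        rw [integral_finsetSum _ fun i _ => ?_]
        · exact Finset.sum_congr rfl fun i _ => integral_finsetSum _ fun j _ =>
            Integrable.fintype_prod (f := h i j) (hint i j)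
        · exact integrable_finsetSum _ fun j _ => Integrable.fintype_prod (f := h i j) (hint i j)
    _ = ∑ _i : Fin n, (∫ x, a x ^ 2 * w x) * (∫ x, w x) ^ (n - 1) := by
        refine Finset.sum_congr rfl fun i _ => ?_
        simp_rw [hval i]
        rw [Finset.sum_ite_eq, if_pos (Finset.mem_univ i)]
    _ = n * (∫ x, w x) ^ (n - 1) * ∫ x, a x ^ 2 * w x := by
        rw [Finset.sum_const, Finset.card_univ, Fintype.card_fin, nsmul_eq_mul]; ring

variable {g : ℝ → ℝ} {τ : ℝ}

/-- **The tail bound (Maynard 2015, (8.6)–(8.10)).** For measurable `0 ≤ g ≤ 1` supported in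
`[0, τ]` with `γ = ∫ g² > 0`, `μ₁ = ∫ x g(x)²` and `n μ₁/γ < 1 − τ`:
`∫_{∑ sⱼ > 1 − τ} ∏ⱼ g(sⱼ)² ds ≤ n γ^{n−1} τ μ₁ / (1 − τ − n μ₁/γ)²`. Proof as printed: on the tail,
`1 ≤ η^{-2} (∑ⱼ sⱼ − n μ₁/γ)²` with `η = 1 − τ − n μ₁/γ`; expand the square
(`integral_sq_sum_mul_prod`, the cross terms vanish) and use `x² g(x)² ≤ τ x g(x)²` on the
support. [cite: MaynardAnnals2015, §8 of arXiv:1311.4600v3, (8.5)–(8.10)] -/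
theorem setIntegral_tail_prod_sq_le (hg : Measurable g) (h0 : ∀ x, 0 ≤ g x) (h1 : ∀ x, g x ≤ 1)
    (hsupp : ∀ x, g x ≠ 0 → x ∈ Icc 0 τ) (hW : 0 < ∫ x, g x ^ 2)
    (hD : n * ((∫ x, x * g x ^ 2) / ∫ x, g x ^ 2) < 1 - τ) :
    ∫ s in {s : Fin n → ℝ | 1 - τ < ∑ j, s j}, ∏ j, g (s j) ^ 2 ≤
      n * (∫ x, g x ^ 2) ^ (n - 1) * (τ * ∫ x, x * g x ^ 2) /
        (1 - τ - n * ((∫ x, x * g x ^ 2) / ∫ x, g x ^ 2)) ^ 2 := by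
  set W := ∫ x, g x ^ 2 with hWdef
  set M1 := ∫ x, x * g x ^ 2 with hM1
  set ν := M1 / W with hν
  set D := 1 - τ - n * ν with hDdef
  have hDpos : 0 < D := by rw [hDdef]; linarith
  -- the weight `w = g²` and the centred variable `a = x - ν`
  obtain ⟨w, hw⟩ : ∃ w : ℝ → ℝ, w = fun x => g x ^ 2 := ⟨_, rfl⟩
  obtain ⟨a, ha⟩ : ∃ a : ℝ → ℝ, a = fun x => x - ν := ⟨_, rfl⟩
  have hwm : Measurable w := by rw [hw]; exact hg.pow_const 2
  have hw0 : ∀ x, 0 ≤ w x := fun x => by rw [hw]; exact sq_nonneg _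
  have hw1 : ∀ x, |w x| ≤ 1 := fun x => by
    rw [hw]; dsimp only
    rw [abs_of_nonneg (sq_nonneg _)]
    exact pow_le_one₀ (h0 x) (h1 x)
  have hwsupp : ∀ x, w x ≠ 0 → x ∈ Icc 0 τ := fun x hx => by
    refine hsupp x fun h => hx ?_
    rw [hw]; dsimp only; rw [h]; ring
  have hwint : Integrable w := integrable_of_forall_mem_Icc hwm hw1 hwsupp
  have hxw : Integrable fun x => x * w x := integrable_mul_of_forall_mem_Icc hwm hw1 hwsupp
    continuous_id
  have hx2w : Integrable fun x => x ^ 2 * w x :=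
    integrable_mul_of_forall_mem_Icc hwm hw1 hwsupp (continuous_pow 2)
  have haw : Integrable fun x => a x * w x := by
    rw [ha]; exact integrable_mul_of_forall_mem_Icc hwm hw1 hwsupp (continuous_id.sub continuous_const)
  have ha2w : Integrable fun x => a x ^ 2 * w x := by
    rw [ha]
    exact integrable_mul_of_forall_mem_Icc hwm hw1 hwsupp ((continuous_id.sub continuous_const).pow 2)
  have hWw : ∫ x, w x = W := by rw [hw]
  have hM1w : ∫ x, x * w x = M1 := by rw [hw]
  have hνW : ν * W = M1 := by rw [hν]; field_simp
  -- `∫ a w = 0`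
  have h0aw : ∫ x, a x * w x = 0 := by
    have : (fun x => a x * w x) = fun x => x * w x - ν * w x := by
      funext x; rw [ha]; dsimp only; ring
    rw [this, integral_sub hxw (hwint.const_mul ν), integral_const_mul, hM1w, hWw, hνW, sub_self]
  -- `∫ a² w ≤ τ M1`
  have ha2le : ∫ x, a x ^ 2 * w x ≤ τ * M1 := by
    have h1' : ∫ x, a x ^ 2 * w x = (∫ x, x ^ 2 * w x) - ν ^ 2 * W := by
      have : (fun x => a x ^ 2 * w x) =
          fun x => x ^ 2 * w x - (2 * ν) * (x * w x) + ν ^ 2 * w x := by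
        funext x; rw [ha]; dsimp only; ring
      rw [this, integral_add (hx2w.sub' (hxw.const_mul _)) (hwint.const_mul _),
        integral_sub hx2w (hxw.const_mul _), integral_const_mul, integral_const_mul, hM1w, hWw,
        ← hνW]
      ring
    have h2' : ∫ x, x ^ 2 * w x ≤ ∫ x, τ * (x * w x) := by
      refine integral_mono hx2w (hxw.const_mul τ) fun x => ?_
      dsimp only
      by_cases hx : w x = 0
      · rw [hx]; simp
      · have hxI := hwsupp x hx
        have : x ^ 2 ≤ τ * x := by nlinarith [hxI.1, hxI.2]
        nlinarith [hw0 x]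
    rw [integral_const_mul, hM1w] at h2'
    have : 0 ≤ ν ^ 2 * W := by positivity
    linarith
  -- pointwise domination of the tail indicator by the second moment
  have hpt : ∀ s : Fin n → ℝ,
      {s : Fin n → ℝ | 1 - τ < ∑ j, s j}.indicator (fun s => ∏ j, w (s j)) s ≤
        D⁻¹ ^ 2 * ((∑ j, a (s j)) ^ 2 * ∏ j, w (s j)) := by
    intro s
    have hP0 : 0 ≤ ∏ j, w (s j) := Finset.prod_nonneg fun j _ => hw0 _
    by_cases hs : s ∈ {s : Fin n → ℝ | 1 - τ < ∑ j, s j}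
    · rw [indicator_of_mem hs]
      have hsum : ∑ j, a (s j) = ∑ j, s j - n * ν := by
        rw [ha]; dsimp only
        rw [Finset.sum_sub_distrib, Finset.sum_const, Finset.card_univ, Fintype.card_fin,
          nsmul_eq_mul]
      have hlt : D < ∑ j, a (s j) := by
        rw [hsum, hDdef]; have := hs; simp only [mem_setOf_eq] at this; linarith
      have h1le : 1 ≤ D⁻¹ ^ 2 * (∑ j, a (s j)) ^ 2 := by
        rw [← mul_pow]
        have : 1 ≤ D⁻¹ * ∑ j, a (s j) := by
          rw [inv_mul_eq_div, le_div_iff₀ hDpos]; linarith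
        nlinarith
      calc ∏ j, w (s j) = 1 * ∏ j, w (s j) := (one_mul _).symm
        _ ≤ (D⁻¹ ^ 2 * (∑ j, a (s j)) ^ 2) * ∏ j, w (s j) :=
            mul_le_mul_of_nonneg_right h1le hP0
        _ = _ := by ring
    · rw [indicator_of_notMem hs]
      have : 0 ≤ (∑ j, a (s j)) ^ 2 := sq_nonneg _
      positivity
  -- integrate
  have hprodint : Integrable fun s : Fin n → ℝ => ∏ j, w (s j) :=
    Integrable.fintype_prod (f := fun _ => w) fun _ => hwint
  have hmeas : MeasurableSet {s : Fin n → ℝ | 1 - τ < ∑ j, s j} :=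
    measurableSet_lt measurable_const (Finset.measurable_sum _ fun i _ => measurable_pi_apply i)
  calc ∫ s in {s : Fin n → ℝ | 1 - τ < ∑ j, s j}, ∏ j, g (s j) ^ 2
      = ∫ s, {s : Fin n → ℝ | 1 - τ < ∑ j, s j}.indicator (fun s => ∏ j, w (s j)) s := by
        rw [integral_indicator hmeas, hw]
    _ ≤ ∫ s : Fin n → ℝ, D⁻¹ ^ 2 * ((∑ j, a (s j)) ^ 2 * ∏ j, w (s j)) :=
        integral_mono (hprodint.indicator hmeas)
          ((integrable_sq_sum_mul_prod hwint haw ha2w).const_mul _) hpt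
    _ = D⁻¹ ^ 2 * (n * W ^ (n - 1) * ∫ x, a x ^ 2 * w x) := by
        rw [integral_const_mul, integral_sq_sum_mul_prod hwint haw ha2w h0aw, hWw]
    _ ≤ D⁻¹ ^ 2 * (n * W ^ (n - 1) * (τ * M1)) := by
        have : 0 ≤ (n : ℝ) * W ^ (n - 1) := by positivity
        gcongr
    _ = n * W ^ (n - 1) * (τ * M1) / D ^ 2 := by
        rw [inv_pow, inv_mul_eq_div]

end SecondMoment

/-! ### The ratio bound (Maynard 2015, (8.11)) -/

section Ratio

variable {n : ℕ} {g : ℝ → ℝ} {τ : ℝ} {G F : (Fin (n + 1) → ℝ) → ℝ}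

/-- `∫₀¹ g = ∫ g` for `g` vanishing off `[0, τ] ⊆ [0, 1]`. [folklore] -/
theorem intervalIntegral_eq_integral_of_forall_mem_Icc (hsupp : ∀ x, g x ≠ 0 → x ∈ Icc 0 τ)
    (hτ1 : τ ≤ 1) : ∫ u in (0 : ℝ)..1, g u = ∫ x, g x := by
  rw [intervalIntegral.integral_of_le zero_le_one, ← integral_Icc_eq_integral_Ioc]
  refine setIntegral_eq_integral_of_forall_compl_eq_zero fun x hx => ?_
  by_contra h
  exact hx (let hm := hsupp x h; ⟨hm.1, hm.2.trans hτ1⟩)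

/-- Splitting `(∫ g²)ⁿ = ∫_{ℝⁿ} ∏ⱼ g(sⱼ)²` into the parts `∑ sⱼ ≤ 1 − τ` and `∑ sⱼ > 1 − τ`
(Maynard 2015, "`J_k ≥ J'_k − E_k`", (8.3)–(8.5)). [cite: MaynardAnnals2015, §8 of arXiv:1311.4600v3, (8.4)–(8.5)] -/
theorem pow_eq_setIntegral_add_setIntegral (hg : Measurable g) (h0 : ∀ x, 0 ≤ g x)
    (h1 : ∀ x, g x ≤ 1) (hsupp : ∀ x, g x ≠ 0 → x ∈ Icc 0 τ) :
    (∫ x, g x ^ 2) ^ n = (∫ s in {s : Fin n → ℝ | ∑ j, s j ≤ 1 - τ}, ∏ j, g (s j) ^ 2) +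
      ∫ s in {s : Fin n → ℝ | 1 - τ < ∑ j, s j}, ∏ j, g (s j) ^ 2 := by
  have habs : ∀ x, |g x| ≤ 1 := fun x => by rw [abs_of_nonneg (h0 x)]; exact h1 x
  have hint : Integrable fun s : Fin n → ℝ => ∏ j, g (s j) ^ 2 :=
    Integrable.fintype_prod (f := fun _ x => g x ^ 2)
      fun _ => integrable_sq_of_forall_mem_Icc hg habs hsupp
  have hAm : MeasurableSet {s : Fin n → ℝ | ∑ j, s j ≤ 1 - τ} :=
    measurableSet_le (Finset.measurable_sum _ fun i _ => measurable_pi_apply i) measurable_const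
  have hcompl : {s : Fin n → ℝ | ∑ j, s j ≤ 1 - τ}ᶜ = {s : Fin n → ℝ | 1 - τ < ∑ j, s j} := by
    ext s; simp [not_le]
  rw [← hcompl, integral_add_compl hAm hint,
    integral_fintype_prod_volume_eq_pow (fun x => g x ^ 2), Fintype.card_fin]

/-- **The ratio bound (Maynard 2015, (8.11)).** For `F = 1_{R_k} ∏ᵢ g(tᵢ)` (`k = n + 1`) with
`g` measurable, `0 ≤ g ≤ 1`, `g ≥ g₀ > 0` on its support `[0, τ]`, `0 < τ ≤ 1`, writing
`γ = ∫ g²`, `ν = (∫ x g²)/γ` and `η = 1 − τ − n ν > 0`, if `n τ ν ≤ η²` then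
`(∑ₘ J_k^{(m)}(F)) / I_k(F) ≥ k (∫ g)² / γ · (1 − n τ ν / η²)`. This is (8.11) of the source in
the unscaled variable `t = u/k` (there `γ`, `μ`, `T` refer to `g(k·)`; the source's slightly
weaker factor `1 − T/(k (1 − T/k − μ)²)` follows from `n ν ≤ k ν = μ_source/k`-type
comparisons and is not needed here). Proof: `I_k ≤ γ^k` (`maynardI_le_pow`), `J_k^{(m)} ≥
(∫ g)² (γⁿ − E)` (`sq_mul_setIntegral_le_maynardJ`, `pow_eq_setIntegral_add_setIntegral`) and
`E ≤ n γ^{n−1} τ (ν γ) / η²` (`setIntegral_tail_prod_sq_le`).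
[cite: MaynardAnnals2015, §8 of arXiv:1311.4600v3, (8.2)–(8.11)] -/
theorem le_maynardFunctional_indicator_prod (hg : Measurable g) (h0 : ∀ x, 0 ≤ g x)
    (h1 : ∀ x, g x ≤ 1) (hsupp : ∀ x, g x ≠ 0 → x ∈ Icc 0 τ) {g₀ : ℝ} (hg₀ : 0 < g₀)
    (hmin : ∀ x ∈ Icc 0 τ, g₀ ≤ g x) (hτ : 0 < τ) (hτ1 : τ ≤ 1)
    (hG : G = fun t => ∏ i, g (t i)) (hF : F = (maynardSimplex (n + 1)).indicator G)
    (hD : n * ((∫ x, x * g x ^ 2) / ∫ x, g x ^ 2) < 1 - τ)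
    (hX : n * τ * ((∫ x, x * g x ^ 2) / ∫ x, g x ^ 2) ≤
      (1 - τ - n * ((∫ x, x * g x ^ 2) / ∫ x, g x ^ 2)) ^ 2) :
    (n + 1) * (∫ x, g x) ^ 2 / (∫ x, g x ^ 2) *
        (1 - n * τ * ((∫ x, x * g x ^ 2) / ∫ x, g x ^ 2) /
          (1 - τ - n * ((∫ x, x * g x ^ 2) / ∫ x, g x ^ 2)) ^ 2) ≤
      maynardFunctional (n + 1) F := by
  set W := ∫ x, g x ^ 2 with hWdef
  set M1 := ∫ x, x * g x ^ 2 with hM1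
  set ν := M1 / W with hν
  set D := 1 - τ - n * ν with hDdef
  set L := ∫ x, g x with hL
  have hDpos : 0 < D := by rw [hDdef]; linarith
  have hadm := isMaynardAdmissible_indicator_prod hg h0 h1 hg₀ hmin hτ hτ1 hG hF
  have hIpos := hadm.maynardI_pos
  have hIle : maynardI (n + 1) F ≤ W ^ (n + 1) := maynardI_le_pow hg h0 h1 hsupp hG hF
  have hW0 : 0 ≤ W := integral_nonneg fun x => sq_nonneg _
  have hWpos : 0 < W := by
    rcases hW0.eq_or_lt with h | h
    · exfalso
      rw [← h, zero_pow (Nat.succ_ne_zero n)] at hIle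
      exact absurd hIle (not_le.2 hIpos)
    · exact h
  have hνW : ν * W = M1 := by rw [hν]; field_simp
  have hM10 : 0 ≤ M1 := integral_nonneg fun x => by
    by_cases hx : g x = 0
    · simp [hx]
    · exact mul_nonneg (hsupp x hx).1 (sq_nonneg _)
  have hν0 : 0 ≤ ν := div_nonneg hM10 hW0
  -- the good part `K` and the tail `E`
  set K := ∫ s in {s : Fin n → ℝ | ∑ j, s j ≤ 1 - τ}, ∏ j, g (s j) ^ 2 with hK
  set E := ∫ s in {s : Fin n → ℝ | 1 - τ < ∑ j, s j}, ∏ j, g (s j) ^ 2 with hE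
  have hsplit : W ^ n = K + E := pow_eq_setIntegral_add_setIntegral hg h0 h1 hsupp
  have hEle : E ≤ n * W ^ (n - 1) * (τ * M1) / D ^ 2 :=
    setIntegral_tail_prod_sq_le hg h0 h1 hsupp hWpos hD
  have hEle' : E ≤ W ^ n * (n * τ * ν / D ^ 2) := by
    refine hEle.trans (le_of_eq ?_)
    rcases Nat.eq_zero_or_pos n with hn | hn
    · subst hn; simp
    · obtain ⟨n', rfl⟩ : ∃ n', n = n' + 1 := ⟨n - 1, by omega⟩
      rw [Nat.add_sub_cancel, ← hνW]
      push_cast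
      ring
  have hKge : W ^ n * (1 - n * τ * ν / D ^ 2) ≤ K := by nlinarith
  -- the `J` lower bound, summed over `m`
  have hc : ∫ u in (0 : ℝ)..1, g u = L := intervalIntegral_eq_integral_of_forall_mem_Icc hsupp hτ1
  have hK' : ∫ s in {s : Fin n → ℝ | ∑ j, s j ≤ 1 - τ}, (∏ j, g (s j)) ^ 2 = K := by
    rw [hK]
    refine integral_congr_ae (ae_of_all _ fun s => ?_)
    show (∏ j, g (s j)) ^ 2 = ∏ j, g (s j) ^ 2
    exact (Finset.prod_pow _ _ _).symm
  have hJ : ∀ m : Fin (n + 1), L ^ 2 * K ≤ maynardJ (n + 1) m F := fun m => by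
    have := sq_mul_setIntegral_le_maynardJ hg h0 h1 hsupp hτ1 hG hF m
    rwa [hc, hK'] at this
  have hsum : (n + 1) * (L ^ 2 * K) ≤ ∑ m, maynardJ (n + 1) m F := by
    have := Finset.sum_le_sum fun m (_ : m ∈ Finset.univ) => hJ m
    rwa [Finset.sum_const, Finset.card_univ, Fintype.card_fin, nsmul_eq_mul, Nat.cast_add,
      Nat.cast_one] at this
  have hX' : 0 ≤ 1 - n * τ * ν / D ^ 2 := by
    rw [sub_nonneg, div_le_one (by positivity)]; exact hX
  have hN0 : 0 ≤ (n + 1) * (L ^ 2 * (W ^ n * (1 - n * τ * ν / D ^ 2))) := by positivity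
  have hNle : (n + 1) * (L ^ 2 * (W ^ n * (1 - n * τ * ν / D ^ 2))) ≤
      ∑ m, maynardJ (n + 1) m F := by
    refine le_trans ?_ hsum
    have hL2 : 0 ≤ L ^ 2 := sq_nonneg _
    have : L ^ 2 * (W ^ n * (1 - n * τ * ν / D ^ 2)) ≤ L ^ 2 * K :=
      mul_le_mul_of_nonneg_left hKge hL2
    nlinarith
  unfold maynardFunctional
  calc (n + 1) * L ^ 2 / W * (1 - n * τ * ν / D ^ 2)
      = (n + 1) * (L ^ 2 * (W ^ n * (1 - n * τ * ν / D ^ 2))) / W ^ (n + 1) := by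
        rw [pow_succ]
        field_simp
        ring
    _ ≤ (n + 1) * (L ^ 2 * (W ^ n * (1 - n * τ * ν / D ^ 2))) / maynardI (n + 1) F :=
        div_le_div_of_nonneg_left hN0 hIpos hIle
    _ ≤ (∑ m, maynardJ (n + 1) m F) / maynardI (n + 1) F :=
        div_le_div_of_nonneg_right hNle hIpos.le

end Ratio

/-! ### The explicit profile `g(x) = 1/(1 + B x)` on `[0, τ]` (Maynard 2015, (8.17)–(8.19)) -/

section ExplicitProfile

variable {B τ : ℝ}

/-- Measurability of the profile `1_{[0,τ]} (1 + Bx)⁻¹`. [folklore] -/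
theorem measurable_indicator_inv :
    Measurable fun x => (Icc 0 τ).indicator (fun x => (1 + B * x)⁻¹) x := by
  refine Measurable.indicator ?_ measurableSet_Icc
  exact (measurable_const.add (measurable_const.mul measurable_id)).inv

/-- `0 ≤ 1_{[0,τ]} (1 + Bx)⁻¹` for `B ≥ 0`. [folklore] -/
theorem indicator_inv_nonneg (hB : 0 ≤ B) (x : ℝ) :
    0 ≤ (Icc 0 τ).indicator (fun x => (1 + B * x)⁻¹) x := by
  by_cases hx : x ∈ Icc 0 τ
  · rw [indicator_of_mem hx]
    have : 0 ≤ B * x := mul_nonneg hB hx.1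
    positivity
  · rw [indicator_of_notMem hx]

/-- `1_{[0,τ]} (1 + Bx)⁻¹ ≤ 1` for `B ≥ 0`. [folklore] -/
theorem indicator_inv_le_one (hB : 0 ≤ B) (x : ℝ) :
    (Icc 0 τ).indicator (fun x => (1 + B * x)⁻¹) x ≤ 1 := by
  by_cases hx : x ∈ Icc 0 τ
  · rw [indicator_of_mem hx]
    have : 0 ≤ B * x := mul_nonneg hB hx.1
    exact inv_le_one_of_one_le₀ (by linarith)
  · rw [indicator_of_notMem hx]; exact zero_le_one

/-- On `[0, τ]` the profile is at least `(1 + Bτ)⁻¹` (`B ≥ 0`). [folklore] -/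
theorem inv_le_indicator_inv (hB : 0 ≤ B) {x : ℝ} (hx : x ∈ Icc 0 τ) :
    (1 + B * τ)⁻¹ ≤ (Icc 0 τ).indicator (fun x => (1 + B * x)⁻¹) x := by
  rw [indicator_of_mem hx]
  have h0 : 0 ≤ B * x := mul_nonneg hB hx.1
  have h1 : B * x ≤ B * τ := mul_le_mul_of_nonneg_left hx.2 hB
  exact inv_anti₀ (by linarith) (by linarith)

/-- `∫ 1_{[0,τ]} φ = ∫₀^τ φ`. [folklore] -/
theorem integral_indicator_Icc_eq_intervalIntegral (hτ : 0 ≤ τ) (φ : ℝ → ℝ) :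
    ∫ x, (Icc 0 τ).indicator φ x = ∫ x in (0 : ℝ)..τ, φ x := by
  rw [integral_indicator measurableSet_Icc, integral_Icc_eq_integral_Ioc,
    intervalIntegral.integral_of_le hτ]

/-- `∫₀^τ dx/(1 + Bx) = log(1 + Bτ)/B` (Maynard 2015, (8.19), first formula, in the variable
`x = u/k`). [cite: MaynardAnnals2015, §8 of arXiv:1311.4600v3, (8.19)] -/
theorem integral_indicator_inv (hB : 0 < B) (hτ : 0 ≤ τ) :
    ∫ x, (Icc 0 τ).indicator (fun x => (1 + B * x)⁻¹) x = Real.log (1 + B * τ) / B := by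
  rw [integral_indicator_Icc_eq_intervalIntegral hτ]
  have hderiv : ∀ x ∈ uIcc 0 τ,
      HasDerivAt (fun x => Real.log (1 + B * x) / B) ((1 + B * x)⁻¹) x := by
    intro x hx
    rw [uIcc_of_le hτ] at hx
    have hpos : 0 < 1 + B * x := by have := mul_nonneg hB.le hx.1; linarith
    have h1 : HasDerivAt (fun x => 1 + B * x) B x := by
      simpa using ((hasDerivAt_id x).const_mul B).const_add 1
    have h2 := (h1.log hpos.ne').div_const B
    exact h2.congr_deriv (by field_simp)
  have hcont : ContinuousOn (fun x => (1 + B * x)⁻¹) (uIcc 0 τ) := by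
    rw [uIcc_of_le hτ]
    refine ContinuousOn.inv₀ (by fun_prop) fun x hx => ?_
    have := mul_nonneg hB.le hx.1; positivity
  rw [intervalIntegral.integral_eq_sub_of_hasDerivAt hderiv (hcont.intervalIntegrable)]
  simp

/-- `∫₀^τ dx/(1 + Bx)² = (1 − 1/(1 + Bτ))/B` (Maynard 2015, (8.19), second formula).
[cite: MaynardAnnals2015, §8 of arXiv:1311.4600v3, (8.19)] -/
theorem integral_indicator_inv_sq (hB : 0 < B) (hτ : 0 ≤ τ) :
    ∫ x, ((Icc 0 τ).indicator (fun x => (1 + B * x)⁻¹) x) ^ 2 = (1 - (1 + B * τ)⁻¹) / B := by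
  have hpt : ∀ x, ((Icc 0 τ).indicator (fun x => (1 + B * x)⁻¹) x) ^ 2 =
      (Icc 0 τ).indicator (fun x => ((1 + B * x) ^ 2)⁻¹) x := fun x => by
    by_cases hx : x ∈ Icc 0 τ
    · rw [indicator_of_mem hx, indicator_of_mem hx, inv_pow]
    · rw [indicator_of_notMem hx, indicator_of_notMem hx]; ring
  simp_rw [hpt]
  rw [integral_indicator_Icc_eq_intervalIntegral hτ]
  have hderiv : ∀ x ∈ uIcc 0 τ,
      HasDerivAt (fun x => -(1 + B * x)⁻¹ / B) (((1 + B * x) ^ 2)⁻¹) x := by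
    intro x hx
    rw [uIcc_of_le hτ] at hx
    have hpos : 0 < 1 + B * x := by have := mul_nonneg hB.le hx.1; linarith
    have h1 : HasDerivAt (fun x => 1 + B * x) B x := by
      simpa using ((hasDerivAt_id x).const_mul B).const_add 1
    have h2 := ((h1.fun_inv hpos.ne').fun_neg).div_const B
    exact h2.congr_deriv (by field_simp)
  have hcont : ContinuousOn (fun x => ((1 + B * x) ^ 2)⁻¹) (uIcc 0 τ) := by
    rw [uIcc_of_le hτ]
    refine ContinuousOn.inv₀ (by fun_prop) fun x hx => ?_
    have := mul_nonneg hB.le hx.1; positivity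
  rw [intervalIntegral.integral_eq_sub_of_hasDerivAt hderiv (hcont.intervalIntegrable)]
  simp only [mul_zero, add_zero, inv_one]
  field_simp
  ring

/-- `∫₀^τ x dx/(1 + Bx)² = (log(1 + Bτ) − 1 + 1/(1 + Bτ))/B²` (Maynard 2015, (8.19), third
formula). [cite: MaynardAnnals2015, §8 of arXiv:1311.4600v3, (8.19)] -/
theorem integral_mul_indicator_inv_sq (hB : 0 < B) (hτ : 0 ≤ τ) :
    ∫ x, x * ((Icc 0 τ).indicator (fun x => (1 + B * x)⁻¹) x) ^ 2 =
      (Real.log (1 + B * τ) - 1 + (1 + B * τ)⁻¹) / B ^ 2 := by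
  have hpt : ∀ x, x * ((Icc 0 τ).indicator (fun x => (1 + B * x)⁻¹) x) ^ 2 =
      (Icc 0 τ).indicator (fun x => x * ((1 + B * x) ^ 2)⁻¹) x := fun x => by
    by_cases hx : x ∈ Icc 0 τ
    · rw [indicator_of_mem hx, indicator_of_mem hx, inv_pow]
    · rw [indicator_of_notMem hx, indicator_of_notMem hx]; ring
  simp_rw [hpt]
  rw [integral_indicator_Icc_eq_intervalIntegral hτ]
  have hderiv : ∀ x ∈ uIcc 0 τ,
      HasDerivAt (fun x => (Real.log (1 + B * x) + (1 + B * x)⁻¹) / B ^ 2)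
        (x * ((1 + B * x) ^ 2)⁻¹) x := by
    intro x hx
    rw [uIcc_of_le hτ] at hx
    have hpos : 0 < 1 + B * x := by have := mul_nonneg hB.le hx.1; linarith
    have h1 : HasDerivAt (fun x => 1 + B * x) B x := by
      simpa using ((hasDerivAt_id x).const_mul B).const_add 1
    have h2 := ((h1.log hpos.ne').fun_add (h1.fun_inv hpos.ne')).div_const (B ^ 2)
    exact h2.congr_deriv (by field_simp; ring)
  have hcont : ContinuousOn (fun x => x * ((1 + B * x) ^ 2)⁻¹) (uIcc 0 τ) := by
    rw [uIcc_of_le hτ]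
    refine ContinuousOn.mul (by fun_prop) (ContinuousOn.inv₀ (by fun_prop) fun x hx => ?_)
    have := mul_nonneg hB.le hx.1; positivity
  rw [intervalIntegral.integral_eq_sub_of_hasDerivAt hderiv (hcont.intervalIntegrable)]
  simp only [mul_zero, add_zero, Real.log_one, inv_one, zero_add]
  field_simp
  ring

end ExplicitProfile

/-! ### The numerical endgame (Maynard 2015, (8.19)–(8.20) and the choice `A = log k − 2 log log k`) -/

section Numerics

/-- `16 ≤ ℓ − 2 log ℓ` for `ℓ ≥ 24` (from `log ℓ ≤ 5 log 2 + ℓ/32 − 1`). [folklore] -/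
theorem sixteen_le_sub_two_mul_log {ℓ : ℝ} (hℓ : 24 ≤ ℓ) : 16 ≤ ℓ - 2 * Real.log ℓ := by
  have hℓpos : 0 < ℓ := by linarith
  have h1 : Real.log ℓ = 5 * Real.log 2 + Real.log (ℓ / 32) := by
    rw [Real.log_div hℓpos.ne' (by norm_num), show (32 : ℝ) = 2 ^ 5 by norm_num, Real.log_pow]
    push_cast; ring
  have h2 : Real.log (ℓ / 32) ≤ ℓ / 32 - 1 := Real.log_le_sub_one_of_pos (by positivity)
  have h3 := Real.log_two_lt_d9
  linarith

/-- **The numerical endgame of Maynard 2015, §8.** In the variable `x = u/k`: with `ℓ = log k ≥ 24`,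
`A = ℓ − 2 log ℓ`, `e = e^A = k/ℓ²`, `τ = T/k = (e^A − 1)/(A k)` and
`ν = μ/k = (A − 1 + e^{−A}) / (A k (1 − e^{−A}))` (the moments (8.19) of `g(u) = 1/(1 + Au)` on
`[0, T]`, `1 + AT = e^A`), one has `0 < τ ≤ 1`, `(k−1) ν < 1 − τ`, `(k−1) τ ν ≤ (1 − τ − (k−1)ν)²`
and `A/(1 − e^{−A}) · (1 − (k−1)τν/(1 − τ − (k−1)ν)²) > ℓ − 2 log ℓ − 2` (the source takes "k
sufficiently large"; here `k ≥ e^{24}` and the constants are explicit: `e^A − 1 ≥ A²/2`,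
`1 − τ − (k−1)ν ≥ 4/(5A)`, and the loss is at most `25/16 < 2`).
[cite: MaynardAnnals2015, §8 of arXiv:1311.4600v3, (8.19)–(8.20)] -/
theorem largeK_numeric_bound {A ℓ kR nR e τ ν : ℝ} (hℓ : 24 ≤ ℓ) (hAdef : A = ℓ - 2 * Real.log ℓ)
    (he : e = Real.exp A) (hke : kR = e * ℓ ^ 2) (hk : kR = nR + 1)
    (hτ : τ = (e - 1) / (A * kR))
    (hν : ν = ((A - 1 + e⁻¹) / (A * kR) ^ 2) / ((1 - e⁻¹) / (A * kR))) :
    0 < τ ∧ τ ≤ 1 ∧ nR * ν < 1 - τ ∧ nR * τ * ν ≤ (1 - τ - nR * ν) ^ 2 ∧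
      ℓ - 2 * Real.log ℓ - 2 <
        (nR + 1) * (A / (A * kR)) ^ 2 / ((1 - e⁻¹) / (A * kR)) *
          (1 - nR * τ * ν / (1 - τ - nR * ν) ^ 2) := by
  have hA : 16 ≤ A := hAdef ▸ sixteen_le_sub_two_mul_log hℓ
  have hlog : 0 ≤ Real.log ℓ := Real.log_nonneg (by linarith)
  have hAℓ : A ≤ ℓ := by rw [hAdef]; linarith
  have hApos : 0 < A := by linarith
  have hℓpos : 0 < ℓ := by linarith
  have he1 : 1 + A + A ^ 2 / 2 ≤ e := by rw [he]; exact Real.quadratic_le_exp_of_nonneg hApos.le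
  have hepos : 0 < e := by rw [he]; exact Real.exp_pos A
  have he_sub : A ^ 2 / 2 ≤ e - 1 := by linarith
  have h16A : 16 * 16 ≤ A * A := mul_le_mul hA hA (by norm_num) hApos.le
  have he128 : 128 ≤ e - 1 := by linarith [h16A, he_sub]
  have h24ℓ : 24 * 24 ≤ ℓ * ℓ := mul_le_mul hℓ hℓ (by norm_num) hℓpos.le
  have hℓ2 : 576 ≤ ℓ ^ 2 := by linarith [h24ℓ]
  have hkpos : 0 < kR := by rw [hke]; positivity
  have hAk : 0 < A * kR := by positivity
  -- `e⁻¹` and `1 - e⁻¹`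
  have heinv : 0 < e⁻¹ := inv_pos.2 hepos
  have h1e : 1 - e⁻¹ = (e - 1) / e := by field_simp
  have h1epos : 0 < 1 - e⁻¹ := by rw [h1e]; exact div_pos (by linarith) hepos
  have h1ele : 1 - e⁻¹ ≤ 1 := by linarith
  -- `τ`
  have hτpos : 0 < τ := by rw [hτ]; exact div_pos (by linarith) hAk
  have hτle : τ ≤ 1 / (A * ℓ ^ 2) := by
    rw [hτ, div_le_div_iff₀ hAk (by positivity), hke]
    have h0 : 0 ≤ A * ℓ ^ 2 := by positivity
    linarith [h0]
  have hτsmall : τ ≤ 1 / (A * 576) :=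
    hτle.trans (one_div_le_one_div_of_le (by positivity)
      (mul_le_mul_of_nonneg_left hℓ2 hApos.le))
  have hτ1 : τ ≤ 1 := hτsmall.trans (by rw [div_le_one (by positivity)]; linarith)
  -- `ν` and `μ = kR ν = 1 - 1/A + 1/(e-1)`
  have hν' : ν = (A - 1 + e⁻¹) / ((A * kR) * (1 - e⁻¹)) := by
    rw [hν]; field_simp
  have hμ : kR * ν = 1 - 1 / A + 1 / (e - 1) := by
    have hem1 : e - 1 ≠ 0 := by linarith
    rw [hν', h1e]
    field_simp
    ring
  have hν0 : 0 ≤ ν := by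
    rw [hν']
    exact div_nonneg (by linarith) (by positivity)
  have hnk : nR ≤ kR := by linarith
  have hnν : nR * ν ≤ 1 - 1 / A + 1 / (e - 1) := by
    rw [← hμ]; exact mul_le_mul_of_nonneg_right hnk hν0
  have hinv_e : 1 / (e - 1) ≤ 1 / (8 * A) := by
    refine one_div_le_one_div_of_le (by positivity) ?_
    have h16A' : 16 * A ≤ A * A := mul_le_mul_of_nonneg_right hA hApos.le
    linarith [h16A', he_sub]
  have h8A : 1 / (8 * A) ≤ 1 / A := one_div_le_one_div_of_le hApos (by linarith)
  have hμ1 : nR * ν ≤ 1 := by linarith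
  -- `D = 1 - τ - nR ν ≥ 4/(5A)`
  set D := 1 - τ - nR * ν with hD
  have hDge : 4 / (5 * A) ≤ D := by
    have h1 : 1 - 1 / (A * 576) - (1 - 1 / A + 1 / (8 * A)) ≤ D := by linarith
    have h2 : 4 / (5 * A) ≤ 1 - 1 / (A * 576) - (1 - 1 / A + 1 / (8 * A)) := by
      rw [show 1 - 1 / (A * 576) - (1 - 1 / A + 1 / (8 * A)) = (503 / 576) / A by
        field_simp; ring]
      rw [div_le_div_iff₀ (by positivity) hApos]
      linarith
    linarith
  have hD45 : 0 < 4 / (5 * A) := by positivity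
  have hDpos : 0 < D := lt_of_lt_of_le hD45 hDge
  -- the error term `X = nR τ ν / D²`
  have hX : nR * τ * ν ≤ τ := by
    have := mul_le_mul_of_nonneg_left hμ1 hτpos.le
    linarith [this]
  have hXD : nR * τ * ν / D ^ 2 ≤ 25 * A / (16 * ℓ ^ 2) := by
    calc nR * τ * ν / D ^ 2 ≤ τ / D ^ 2 := div_le_div_of_nonneg_right hX (by positivity)
      _ ≤ (1 / (A * ℓ ^ 2)) / (4 / (5 * A)) ^ 2 := by
          gcongr
      _ = 25 * A / (16 * ℓ ^ 2) := by field_simp; ring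
  have h25A : 25 * A / (16 * ℓ ^ 2) ≤ 1 := by
    rw [div_le_one (by positivity)]
    have h1 : ℓ * 25 ≤ ℓ * (16 * ℓ) :=
      mul_le_mul_of_nonneg_left (show (25:ℝ) ≤ 16 * ℓ by linarith) hℓpos.le
    linarith [h1]
  have hX1 : nR * τ * ν ≤ D ^ 2 := by
    have hD2 : 0 < D ^ 2 := by positivity
    have := hXD.trans h25A
    rwa [div_le_one hD2] at this
  -- the main term `(nR + 1) (A/(A kR))² / ((1 - e⁻¹)/(A kR)) = A / (1 - e⁻¹)`
  have hmain : (nR + 1) * (A / (A * kR)) ^ 2 / ((1 - e⁻¹) / (A * kR)) = A / (1 - e⁻¹) := by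
    rw [← hk]
    field_simp
  refine ⟨hτpos, hτ1, by linarith [hDpos], hX1, ?_⟩
  rw [hmain]
  have hXnn : 0 ≤ 1 - nR * τ * ν / D ^ 2 := by
    rw [sub_nonneg, div_le_one (by positivity)]; exact hX1
  have hAX : A * (1 - nR * τ * ν / D ^ 2) ≤ A / (1 - e⁻¹) * (1 - nR * τ * ν / D ^ 2) := by
    refine mul_le_mul_of_nonneg_right ?_ hXnn
    rw [le_div_iff₀ h1epos]
    have := mul_le_mul_of_nonneg_left h1ele hApos.le
    linarith
  have h25 : A * (25 * A / (16 * ℓ ^ 2)) ≤ 25 / 16 := by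
    rw [show A * (25 * A / (16 * ℓ ^ 2)) = 25 / 16 * (A ^ 2 / ℓ ^ 2) by ring]
    have : A ^ 2 / ℓ ^ 2 ≤ 1 := by
      rw [div_le_one (by positivity)]
      exact pow_le_pow_left₀ hApos.le hAℓ 2
    linarith
  have hlow : A - 25 / 16 ≤ A * (1 - nR * τ * ν / D ^ 2) := by
    have := mul_le_mul_of_nonneg_left hXD hApos.le
    linarith [this, h25]
  rw [← hAdef]
  linarith

end Numerics

/-! ### Maynard 2015, Proposition 4.3 (3), discharged -/

/-- **Maynard 2015, Prop. 4.3 (3), discharged** (J. Maynard, *Small gaps between primes*, Ann. of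
Math. 181 (2015), 383–413, Proposition 4.3 (3): "if `k` is sufficiently large, `M_k > log k −
2 log log k − 2`", proved in §8 of arXiv:1311.4600v3 (= §7 of the journal version), pp. 17–18).
Here `k ≥ 2^{35}` suffices. Proof as printed: `F(t) = 1_{R_k}(t) ∏ᵢ g(k tᵢ)` with
`g(u) = 1/(1 + Au)` on `[0, T]`, `1 + AT = e^A`, `A = log k − 2 log log k` ((8.1), (8.17)–(8.18));
`I_k ≤ k^{-k} γ^k` ((8.2)); `J_k^{(m)} ≥ J'_k − E_k` by restricting to `∑_{i≠m} tᵢ ≤ 1 − T/k`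
((8.3)–(8.5)); the tail `E_k` is bounded by the second moment ((8.6)–(8.10)); this gives the
ratio bound (8.11), and the moments (8.19) with the stated choices give (8.20). The test function
is admissible in the sense of `IsMaynardAdmissible` (measurable, supported on `R_k`,
square-integrable, `I_k(F) > 0`). [cite: MaynardAnnals2015, Proposition 4.3 (3) and §8 of arXiv:1311.4600v3] -/
theorem _root_.Literature.NumberTheory.Sieve.exists_maynardFunctional_gt_holds : exists_maynardFunctional_gt := by
  refine ⟨2 ^ 35, fun k hk => ?_⟩
  obtain ⟨n, rfl⟩ : ∃ n, k = n + 1 := ⟨k - 1, by omega⟩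
  -- the real parameters `kR = k`, `ℓ = log k`, `A = ℓ - 2 log ℓ`, `e = e^A`, `B = A k`, `τ = T/k`
  obtain ⟨kR, hkR⟩ : ∃ kR : ℝ, kR = (n : ℝ) + 1 := ⟨_, rfl⟩
  have hk35 : (2 : ℝ) ^ 35 ≤ kR := by rw [hkR]; exact_mod_cast hk
  have hkpos : 0 < kR := by rw [hkR]; positivity
  obtain ⟨ℓ, hℓ⟩ : ∃ ℓ : ℝ, ℓ = Real.log kR := ⟨_, rfl⟩
  have hℓ24 : 24 ≤ ℓ := by
    have h1 : Real.log ((2 : ℝ) ^ 35) ≤ ℓ := by rw [hℓ]; exact Real.log_le_log (by positivity) hk35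
    rw [Real.log_pow] at h1
    have h2 := Real.log_two_gt_d9
    push_cast at h1
    linarith
  have hℓpos : 0 < ℓ := by linarith
  obtain ⟨A, hA⟩ : ∃ A : ℝ, A = ℓ - 2 * Real.log ℓ := ⟨_, rfl⟩
  have hA16 : 16 ≤ A := hA ▸ sixteen_le_sub_two_mul_log hℓ24
  have hApos : 0 < A := by linarith
  obtain ⟨e, he⟩ : ∃ e : ℝ, e = Real.exp A := ⟨_, rfl⟩
  have hepos : 0 < e := by rw [he]; exact Real.exp_pos A
  have hke : kR = e * ℓ ^ 2 := by
    have h1 : Real.exp ℓ = kR := by rw [hℓ, Real.exp_log hkpos]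
    have h2 : Real.exp (2 * Real.log ℓ) = ℓ ^ 2 := by
      rw [two_mul, Real.exp_add, Real.exp_log hℓpos, sq]
    rw [he, hA, Real.exp_sub, h1, h2]
    field_simp
  have he1 : 1 < e := by
    rw [he]
    have := Real.add_one_le_exp A
    linarith
  obtain ⟨B, hB⟩ : ∃ B : ℝ, B = A * kR := ⟨_, rfl⟩
  have hBpos : 0 < B := by rw [hB]; positivity
  obtain ⟨τ, hτ⟩ : ∃ τ : ℝ, τ = (e - 1) / (A * kR) := ⟨_, rfl⟩
  have hτ0 : 0 ≤ τ := by rw [hτ]; exact div_nonneg (by linarith) (by positivity)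
  have hBτ : 1 + B * τ = e := by
    rw [hB, hτ]; field_simp; ring
  -- the profile `g` and the test function `F`
  obtain ⟨g, hg⟩ : ∃ g : ℝ → ℝ, g = fun x => (Icc 0 τ).indicator (fun x => (1 + B * x)⁻¹) x :=
    ⟨_, rfl⟩
  have hgm : Measurable g := by rw [hg]; exact measurable_indicator_inv
  have hg0 : ∀ x, 0 ≤ g x := fun x => by rw [hg]; exact indicator_inv_nonneg hBpos.le x
  have hg1 : ∀ x, g x ≤ 1 := fun x => by rw [hg]; exact indicator_inv_le_one hBpos.le x
  have hgsupp : ∀ x, g x ≠ 0 → x ∈ Icc 0 τ := fun x hx =>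
    Set.mem_of_indicator_ne_zero (by rwa [hg] at hx)
  have hg₀ : 0 < (1 + B * τ)⁻¹ := by rw [hBτ]; positivity
  have hgmin : ∀ x ∈ Icc 0 τ, (1 + B * τ)⁻¹ ≤ g x := fun x hx => by
    rw [hg]; exact inv_le_indicator_inv hBpos.le hx
  -- its moments (8.19)
  have hL : ∫ x, g x = A / (A * kR) := by
    have : ∫ x, g x = Real.log (1 + B * τ) / B := by rw [hg]; exact integral_indicator_inv hBpos hτ0
    rw [this, hBτ, he, Real.log_exp, hB]
  have hW : ∫ x, g x ^ 2 = (1 - e⁻¹) / (A * kR) := by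
    have : ∫ x, g x ^ 2 = (1 - (1 + B * τ)⁻¹) / B := by
      rw [hg]; exact integral_indicator_inv_sq hBpos hτ0
    rw [this, hBτ, hB]
  have hM1 : ∫ x, x * g x ^ 2 = (A - 1 + e⁻¹) / (A * kR) ^ 2 := by
    have : ∫ x, x * g x ^ 2 = (Real.log (1 + B * τ) - 1 + (1 + B * τ)⁻¹) / B ^ 2 := by
      rw [hg]; exact integral_mul_indicator_inv_sq hBpos hτ0
    rw [this, hBτ, he, Real.log_exp, hB, ← he]
  -- the numerical endgame
  set ν := (∫ x, x * g x ^ 2) / ∫ x, g x ^ 2 with hν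
  have hν' : ν = ((A - 1 + e⁻¹) / (A * kR) ^ 2) / ((1 - e⁻¹) / (A * kR)) := by
    rw [hν, hW, hM1]
  obtain ⟨hτpos, hτ1, hD, hX, hfinal⟩ :=
    largeK_numeric_bound hℓ24 hA he hke hkR hτ hν'
  -- the ratio bound (8.11) for this `F`
  have hratio := le_maynardFunctional_indicator_prod (n := n) hgm hg0 hg1 hgsupp hg₀ hgmin hτpos
    hτ1 rfl rfl hD hX
  rw [← hν, hL, hW] at hratio
  refine ⟨(maynardSimplex (n + 1)).indicator fun t => ∏ i, g (t i),
    isMaynardAdmissible_indicator_prod hgm hg0 hg1 hg₀ hgmin hτpos hτ1 rfl rfl, ?_⟩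
  have hcast : (((n + 1 : ℕ) : ℝ)) = kR := by rw [hkR]; push_cast; ring
  rw [hcast, ← hℓ]
  exact lt_of_lt_of_le hfinal hratio

end MaynardLargeK

end Literature.NumberTheory.Sieve
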